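import Mathlib

/-!
# T5FiniteCopiesModule — a finite orthogonal sum of copies of `F` is `J → F`, as a unitary
`G`-module and as a `ℂ[G]`-module

Cell pub-hodge-repro2, seat p5, Tier 5 (route/T5-N4-p5.md, N4.3 v13 (A3) STEP 5: «L_{π_∞} ∩ L^{K_f}
= m_{K_f}(π_∞) H_{π_∞}», and its dimension count «dim π₀^{K_f}[τ] ≤ m_{K_f}(π_∞) · dim (H_{π_∞})_τ»
taken over the `K_∞`-type `τ`).  Row 76 (`T5IsotypicInvariantsFinite.inf_eq_sSup_of_decomposition`)
exhibits `L_π ⊓ L^{K_f}` as the sum `sSup S_π` of a FINITE pairwise-orthogonal family of closed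
subspaces, each a copy of `H_π` through an intertwining isometry.  This file is the bridge from that
Hilbert-space shape to the module-theoretic shape consumed by the dimension count (row 25 / row 77:
a module equivalent to `ι → H`): for a finite family `W j` of pairwise orthogonal subspaces of a
Hilbert space `E` and isometries `V j : F ≃ₗᵢ[ℂ] W j`,

* `sumMap`, `sumEquiv`: `(x_j) ↦ ∑_j V_j x_j` is a linear equivalence `(J → F) ≃ₗ[ℂ] ⨆ j, W j`
  (injective by the Pythagorean identity of an `OrthogonalFamily`, onto by construction);
* `sumIsometryEquiv`: the same map is a linear isometry equivalence from the `ℓ²`-sum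
  `PiLp 2 (fun _ : J => F)`;
* for representations `ρ : G →* (E →L[ℂ] E)`, `σ : G →* (F →L[ℂ] F)` with every `V j`
  intertwining (`V j (σ g x) = ρ g (V j x)`): `iSup_stable` (the sum is `ρ`-stable),
  `sumRepEquiv` (an equivalence of representations between the product representation `piRep` on
  `J → F` and the subrepresentation of `ρ` on `⨆ j, W j`), and
* **`copiesModuleEquiv`**: the induced `ℂ[G]`-linear equivalence
  `(subrepresentation on ⨆ j, W j).asModule ≃ₗ[ℂ[G]] (J → (toRep σ).asModule)` — the displayed
  identity in the vocabulary of modules over the group algebra, ready for the isotypic dimension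
  count of row 25 / row 77 with `R := ℂ[K_∞]`, `H := H_{π_∞}`, `ι := S_π`;
* the general bridges used on the way: `toRep` (forget continuity), `piRep` (the product
  representation), `asModuleEquivOfEquiv` (an equivalence of representations is a `ℂ[G]`-linear
  equivalence of the associated modules), `piAsModuleEquiv` (`(piRep τ J).asModule` is the
  product module `J → τ.asModule`).

Mathlib only.  Axioms: propext, Classical.choice, Quot.sound.
README §8(d): uses an L-value-free non-vanishing device: NO.
-/

namespace Summit.Ventures.HodgeRepro2.T5FiniteCopiesModule

open scoped InnerProductSpace
open MonoidAlgebra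

/-! ### Continuous representations as `Representation`s -/

section ToRep

variable {E : Type*} [NormedAddCommGroup E] [InnerProductSpace ℂ E]
variable {G : Type*} [Monoid G]

/-- A representation by continuous linear operators, `ρ : G →* (E →L[ℂ] E)` (the convention of the
whole p5 annex), read as a Mathlib `Representation ℂ G E` (continuity forgotten). -/
def toRep (ρ : G →* (E →L[ℂ] E)) : Representation ℂ G E where
  toFun g := (ρ g : E →ₗ[ℂ] E)
  map_one' := by ext; simp
  map_mul' g h := by ext; simp

/-- `toRep ρ g x = ρ g x`. -/
@[simp] theorem toRep_apply (ρ : G →* (E →L[ℂ] E)) (g : G) (x : E) : toRep ρ g x = ρ g x := rfl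

end ToRep

/-! ### The product representation on `J → F` -/

section PiRep

variable {k : Type*} [CommSemiring k] {G : Type*} [Monoid G]
variable {F : Type*} [AddCommMonoid F] [Module k F]

/-- The product representation of `τ` on `J → F`: `g` acts coordinatewise. -/
def piRep (τ : Representation k G F) (J : Type*) : Representation k G (J → F) where
  toFun g := LinearMap.pi fun j => τ g ∘ₗ LinearMap.proj j
  map_one' := by ext; simp
  map_mul' g h := by ext; simp

/-- `piRep τ J g x j = τ g (x j)`. -/
@[simp] theorem piRep_apply (τ : Representation k G F) (J : Type*) (g : G) (x : J → F) (j : J) :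
    piRep τ J g x j = τ g (x j) := rfl

end PiRep

/-! ### Equivalences of representations give `k[G]`-linear equivalences of the modules -/

section AsModule

variable {k : Type*} [CommSemiring k] {G : Type*} [Monoid G]
variable {V₁ V₂ : Type*} [AddCommMonoid V₁] [Module k V₁] [AddCommMonoid V₂] [Module k V₂]

/-- An equivalence of representations `e : ρ₁.Equiv ρ₂` is a `k[G]`-linear equivalence of the
associated modules `ρ₁.asModule ≃ₗ[k[G]] ρ₂.asModule` (Mathlib's
`Representation.IntertwiningMap.equivLinearMapAsModule` applied to `e` and to `e.symm`). -/
noncomputable def asModuleEquivOfEquiv {ρ₁ : Representation k G V₁} {ρ₂ : Representation k G V₂}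
    (e : ρ₁.Equiv ρ₂) : ρ₁.asModule ≃ₗ[MonoidAlgebra k G] ρ₂.asModule :=
  LinearEquiv.ofLinear
    (Representation.IntertwiningMap.equivLinearMapAsModule ρ₁ ρ₂ e.toIntertwiningMap)
    (Representation.IntertwiningMap.equivLinearMapAsModule ρ₂ ρ₁ e.symm.toIntertwiningMap)
    (by ext x; exact e.apply_symm_apply x)
    (by ext x; exact e.symm_apply_apply x)

/-- `asModuleEquivOfEquiv e x = e x`. -/
theorem asModuleEquivOfEquiv_apply {ρ₁ : Representation k G V₁} {ρ₂ : Representation k G V₂}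
    (e : ρ₁.Equiv ρ₂) (x : ρ₁.asModule) :
    (asModuleEquivOfEquiv e x : V₂) = e (ρ₁.asModuleEquiv x) := rfl

variable {F : Type*} [AddCommMonoid F] [Module k F]

/-- The module of the product representation `piRep τ J` is the product module `J → τ.asModule`
(the identity map is `k[G]`-linear: check on `single g c`). -/
noncomputable def piAsModuleEquiv (τ : Representation k G F) (J : Type*) :
    (piRep τ J).asModule ≃ₗ[MonoidAlgebra k G] (J → τ.asModule) where
  toFun x := fun j => τ.asModuleEquiv.symm ((piRep τ J).asModuleEquiv x j)
  invFun y := (piRep τ J).asModuleEquiv.symm (fun j => τ.asModuleEquiv (y j))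
  left_inv _ := rfl
  right_inv _ := rfl
  map_add' _ _ := rfl
  map_smul' r x := by
    simp only [RingHom.id_apply]
    induction r using MonoidAlgebra.induction_linear with
    | zero => ext j; simp
    | add a b ha hb =>
      ext j
      have ha' : τ.asModuleEquiv.symm ((piRep τ J).asModuleEquiv (a • x) j) =
          (a • fun j => τ.asModuleEquiv.symm ((piRep τ J).asModuleEquiv x j)) j := congrFun ha j
      have hb' : τ.asModuleEquiv.symm ((piRep τ J).asModuleEquiv (b • x) j) =
          (b • fun j => τ.asModuleEquiv.symm ((piRep τ J).asModuleEquiv x j)) j := congrFun hb j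
      rw [add_smul, add_smul, Pi.add_apply, ← ha', ← hb', map_add, Pi.add_apply, map_add]
    | single g c =>
      ext j
      simp only [Pi.smul_apply, Representation.single_smul]
      rfl

/-- `piAsModuleEquiv τ J x j = x j`. -/
theorem piAsModuleEquiv_apply (τ : Representation k G F) (J : Type*) (x : (piRep τ J).asModule)
    (j : J) : (τ.asModuleEquiv (piAsModuleEquiv τ J x j) : F) = (piRep τ J).asModuleEquiv x j := rfl

end AsModule

/-! ### A finite orthogonal family of copies of `F` -/

section Family

variable {E F : Type*} [NormedAddCommGroup E] [InnerProductSpace ℂ E]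
  [NormedAddCommGroup F] [InnerProductSpace ℂ F]
variable {J : Type*} [Fintype J] (W : J → Submodule ℂ E) (V : ∀ j, F ≃ₗᵢ[ℂ] W j)

/-- The summation map `(x_j)_j ↦ ∑_j V_j x_j : (J → F) → E`. -/
noncomputable def sumMap : (J → F) →ₗ[ℂ] E :=
  ∑ j, (W j).subtype ∘ₗ ((V j).toLinearEquiv : F →ₗ[ℂ] W j) ∘ₗ LinearMap.proj j

/-- `sumMap W V x = ∑ j, V j (x j)`. -/
theorem sumMap_apply (x : J → F) : sumMap W V x = ∑ j, ((V j) (x j) : E) := by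
  simp [sumMap, LinearMap.sum_apply]

/-- The family of isometries `F →ₗᵢ[ℂ] E`, `x ↦ V j x`. -/
noncomputable def copyIsometry (j : J) : F →ₗᵢ[ℂ] E :=
  (W j).subtypeₗᵢ.comp (V j).toLinearIsometry

omit [Fintype J] in
/-- `copyIsometry W V j x = V j x`. -/
@[simp] theorem copyIsometry_apply (j : J) (x : F) : copyIsometry W V j x = ((V j) x : E) := rfl

omit [Fintype J] in
/-- Pairwise orthogonal `W j` make the copies an `OrthogonalFamily`. -/
theorem orthogonalFamily_copyIsometry (hW : Pairwise fun i j => W i ⟂ W j) :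
    OrthogonalFamily ℂ (fun _ : J => F) (copyIsometry W V) := by
  intro i j hij v w
  simp only [copyIsometry_apply]
  exact Submodule.isOrtho_iff_inner_eq.mp (hW hij) _ ((V i) v).2 _ ((V j) w).2

/-- Pythagoras on the copies: `‖∑ j, V j (x j)‖ ^ 2 = ∑ j, ‖x j‖ ^ 2`. -/
theorem norm_sumMap_sq (hW : Pairwise fun i j => W i ⟂ W j) (x : J → F) :
    ‖sumMap W V x‖ ^ 2 = ∑ j, ‖x j‖ ^ 2 := by
  have h := (orthogonalFamily_copyIsometry W V hW).norm_sum x Finset.univ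
  simpa [sumMap_apply] using h

/-- `sumMap W V x = 0 ↔ x = 0` (pairwise orthogonal copies). -/
theorem sumMap_eq_zero_iff (hW : Pairwise fun i j => W i ⟂ W j) (x : J → F) :
    sumMap W V x = 0 ↔ x = 0 := by
  constructor
  · intro h
    have hn := norm_sumMap_sq W V hW x
    rw [h, norm_zero] at hn
    have h0 : ∑ j, ‖x j‖ ^ 2 = 0 := by simpa using hn.symm
    funext j
    have hj := (Finset.sum_eq_zero_iff_of_nonneg (fun j _ => sq_nonneg ‖x j‖)).mp h0 j
      (Finset.mem_univ j)
    exact norm_eq_zero.mp (pow_eq_zero_iff two_ne_zero |>.mp hj)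
  · rintro rfl
    exact map_zero _

/-- `sumMap W V` is injective (pairwise orthogonal copies). -/
theorem sumMap_injective (hW : Pairwise fun i j => W i ⟂ W j) :
    Function.Injective (sumMap W V) :=
  (injective_iff_map_eq_zero _).mpr fun x hx => (sumMap_eq_zero_iff W V hW x).mp hx

/-- The range of `sumMap W V` is the sum `⨆ j, W j`. -/
theorem range_sumMap : LinearMap.range (sumMap W V) = ⨆ j, W j := by
  classical
  apply le_antisymm
  · rintro _ ⟨x, rfl⟩
    rw [sumMap_apply]
    exact Submodule.sum_mem _ fun j _ => Submodule.mem_iSup_of_mem j ((V j) (x j)).2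
  · refine iSup_le fun j w hw => ?_
    refine ⟨Pi.single j ((V j).symm ⟨w, hw⟩), ?_⟩
    rw [sumMap_apply, Finset.sum_eq_single j]
    · simp
    · intro i _ hi
      simp [Pi.single_eq_of_ne hi]
    · intro h
      exact absurd (Finset.mem_univ j) h

/-- **The finite orthogonal sum of copies of `F` is `J → F`**: the linear equivalence
`(J → F) ≃ₗ[ℂ] ⨆ j, W j`, `x ↦ ∑ j, V j (x j)`. -/
noncomputable def sumEquiv (hW : Pairwise fun i j => W i ⟂ W j) :
    (J → F) ≃ₗ[ℂ] ↥(⨆ j, W j) :=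
  (LinearEquiv.ofInjective (sumMap W V) (sumMap_injective W V hW)).trans
    (LinearEquiv.ofEq _ _ (range_sumMap W V))

/-- `sumEquiv W V hW x = ∑ j, V j (x j)` in `E`. -/
theorem coe_sumEquiv_apply (hW : Pairwise fun i j => W i ⟂ W j) (x : J → F) :
    ((sumEquiv W V hW x : ↥(⨆ j, W j)) : E) = ∑ j, ((V j) (x j) : E) := by
  simp [sumEquiv, sumMap_apply]

/-- The inner product of two sums of copies: `⟪∑ V j (x j), ∑ V j (y j)⟫ = ∑ ⟪x j, y j⟫`. -/
theorem inner_sumMap_sumMap (hW : Pairwise fun i j => W i ⟂ W j) (x y : J → F) :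
    ⟪sumMap W V x, sumMap W V y⟫_ℂ = ∑ j, ⟪x j, y j⟫_ℂ := by
  have h := (orthogonalFamily_copyIsometry W V hW).inner_sum x y Finset.univ
  simp only [copyIsometry_apply] at h
  rw [sumMap_apply, sumMap_apply]
  exact h

/-- **The same map as a linear isometry equivalence** from the `ℓ²`-sum `PiLp 2 (fun _ : J => F)`
onto `⨆ j, W j`. -/
noncomputable def sumIsometryEquiv (hW : Pairwise fun i j => W i ⟂ W j) :
    PiLp 2 (fun _ : J => F) ≃ₗᵢ[ℂ] ↥(⨆ j, W j) :=
  LinearEquiv.isometryOfInner ((WithLp.linearEquiv 2 ℂ (J → F)).trans (sumEquiv W V hW))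
    (by
      intro x y
      rw [Submodule.coe_inner, LinearEquiv.trans_apply, LinearEquiv.trans_apply,
        coe_sumEquiv_apply, coe_sumEquiv_apply, PiLp.inner_apply]
      have h := inner_sumMap_sumMap W V hW (WithLp.linearEquiv 2 ℂ (J → F) x)
        (WithLp.linearEquiv 2 ℂ (J → F) y)
      rw [sumMap_apply, sumMap_apply] at h
      exact h)

/-- `sumIsometryEquiv W V hW x = ∑ j, V j (x j)` in `E`. -/
theorem coe_sumIsometryEquiv_apply (hW : Pairwise fun i j => W i ⟂ W j)
    (x : PiLp 2 (fun _ : J => F)) :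
    ((sumIsometryEquiv W V hW x : ↥(⨆ j, W j)) : E) = ∑ j, ((V j) (x j) : E) := by
  simp [sumIsometryEquiv, coe_sumEquiv_apply]

end Family

/-! ### Intertwining copies: the sum as a representation and as a `ℂ[G]`-module -/

section Rep

variable {E F : Type*} [NormedAddCommGroup E] [InnerProductSpace ℂ E]
  [NormedAddCommGroup F] [InnerProductSpace ℂ F]
variable {G : Type*} [Monoid G] (ρ : G →* (E →L[ℂ] E)) (σ : G →* (F →L[ℂ] F))
variable {J : Type*} [Fintype J] (W : J → Submodule ℂ E) (V : ∀ j, F ≃ₗᵢ[ℂ] W j)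

/-- Equivariance of the summation map: `∑ j, V j (σ g (x j)) = ρ g (∑ j, V j (x j))`. -/
theorem sumMap_comm (hV : ∀ j g x, ((V j) (σ g x) : E) = ρ g (V j x)) (g : G) (x : J → F) :
    sumMap W V (fun j => σ g (x j)) = ρ g (sumMap W V x) := by
  simp only [sumMap_apply, hV, map_sum]

/-- The sum `⨆ j, W j` of intertwining copies is `ρ`-stable (each `W j` is the range of `V j`). -/
theorem iSup_stable (hV : ∀ j g x, ((V j) (σ g x) : E) = ρ g (V j x)) (g : G) :
    (⨆ j, W j) ≤ (⨆ j, W j).comap (toRep ρ g) := by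
  intro w hw
  rw [← range_sumMap W V] at hw ⊢
  obtain ⟨x, rfl⟩ := hw
  refine Submodule.mem_comap.mpr ⟨fun j => σ g (x j), ?_⟩
  rw [sumMap_comm ρ σ W V hV g x]
  rfl

/-- The subrepresentation of `toRep ρ` on the `ρ`-stable sum `⨆ j, W j`. -/
noncomputable def sumSubrep (hV : ∀ j g x, ((V j) (σ g x) : E) = ρ g (V j x)) :
    Representation ℂ G ↥(⨆ j, W j) :=
  (toRep ρ).subrepresentation (⨆ j, W j) (iSup_stable ρ σ W V hV)

/-- `sumSubrep … g w = ρ g w` in `E`. -/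
@[simp] theorem coe_sumSubrep_apply (hV : ∀ j g x, ((V j) (σ g x) : E) = ρ g (V j x)) (g : G)
    (w : ↥(⨆ j, W j)) : (sumSubrep ρ σ W V hV g w : E) = ρ g w := rfl

/-- **The sum of intertwining copies is the product representation**: `sumEquiv` is an
equivalence of representations `piRep (toRep σ) J ≃ sumSubrep`. -/
noncomputable def sumRepEquiv (hW : Pairwise fun i j => W i ⟂ W j)
    (hV : ∀ j g x, ((V j) (σ g x) : E) = ρ g (V j x)) :
    (piRep (toRep σ) J).Equiv (sumSubrep ρ σ W V hV) :=
  Representation.Equiv.mk (sumEquiv W V hW) (by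
    intro g
    ext x
    simp only [LinearMap.comp_apply, LinearEquiv.coe_coe, coe_sumSubrep_apply,
      coe_sumEquiv_apply]
    simp only [piRep_apply, toRep_apply, hV, map_sum])

/-- **The displayed identity as `ℂ[G]`-modules**: the module of the subrepresentation on the sum
of `J` intertwining pairwise-orthogonal copies of `F` is the product module
`J → (toRep σ).asModule` — the input shape of the isotypic dimension count
(row 25 / row 77: `M ≃ₗ[R] (ι → H)` with `R := ℂ[G]`, `H := (toRep σ).asModule`, `ι := J`). -/
noncomputable def copiesModuleEquiv (hW : Pairwise fun i j => W i ⟂ W j)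
    (hV : ∀ j g x, ((V j) (σ g x) : E) = ρ g (V j x)) :
    (sumSubrep ρ σ W V hV).asModule ≃ₗ[MonoidAlgebra ℂ G] (J → (toRep σ).asModule) :=
  (asModuleEquivOfEquiv (sumRepEquiv ρ σ W V hW hV)).symm.trans (piAsModuleEquiv (toRep σ) J)

/-- `copiesModuleEquiv` reads off the coordinates: `∑ j, V j (x j) ↦ x`. -/
theorem copiesModuleEquiv_symm_apply (hW : Pairwise fun i j => W i ⟂ W j)
    (hV : ∀ j g x, ((V j) (σ g x) : E) = ρ g (V j x)) (x : J → F) :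
    (((sumSubrep ρ σ W V hV).asModuleEquiv ((copiesModuleEquiv ρ σ W V hW hV).symm
      ((piAsModuleEquiv (toRep σ) J) ((piRep (toRep σ) J).asModuleEquiv.symm x))) :
        ↥(⨆ j, W j)) : E) = ∑ j, ((V j) (x j) : E) := by
  change ((sumEquiv W V hW x : ↥(⨆ j, W j)) : E) = _
  exact coe_sumEquiv_apply W V hW x

end Rep

end Summit.Ventures.HodgeRepro2.T5FiniteCopiesModule
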